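/-
Copyright (c) 2026 the pub-hodgecm-mathlib formalisation cell (harness21).  Prover seat hodgecm-mathlib-B-p14 (g33), 2026-09-01.  Road «W′» = «R1LL-WILD»
((W′-B6) sub-socket (B6-V) «value laws on the torus», owner B-p14 (g33)): RENORMALISING THE SHELL AVERAGE `fbar` on `H_v = U(Φ₂)_v × U(Φ₁)_v` by a root-stabiliser lift.
-/
import Literature.NumberTheory.Automorphic.UnitaryTwoDescentConjugateNormalForm    -- ★ p844158 (this seat): descent under conjugation by a lift, stabiliser lifts, `setIntegral_conj_eq_of_conj_by_mem`
import Literature.NumberTheory.Rogawski1990.RankOneKappaOrbitalUnfoldingTree        -- ★ p843981…p844098 (this seat): the `H_v` carrier, `fbar`'s shape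
import HarnessLib

/-!
# Renormalising the shell average on `H_v`: `∫_{K×U₁} f(k⁻¹ (E₂⁻¹ X, a) k) = ∫_{K×U₁} f(k⁻¹ (E₂⁻¹ X′, a) k)` for `X′ = k̃⁻¹ X k̃`, `k̃` a root-stabiliser lift
# (road «W′», (B6-V): the `K`-renormalisation step of Labesse–Langlands (2.1)–(2.2))

Topic `NumberTheory/Rogawski1990`; namespace `Literature.NumberTheory.Rogawski1990`.  THEOREMS ONLY (no definition, no instance, no notation, no named fact, no `sorry`); kernel
lane.  Cell `pub/hodgecm-mathlib`, crux H413 = stmt-HodgeConjecture-24833; road «W′» = «R1LL-WILD» (architect A-p16 (g28); (W′-B6) F0P3-p01 (g14), sub-socket (B6-V) — owner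
B-p14 (g33) per p08 (g15) 12:11:43Z; census `B-provers/B-p14/g33/CENSUS-B6V-ValueLaws.B-p14g33.md`).
HONEST LABEL: HC_CM is proved only modulo the cell's 2 remaining named inputs (hLiu418, h413) until rung 0 closes; bookkeeping over ★ p844158, print cited for orientation.

THE MATHEMATICS [LabesseLanglands1979 §2 p. 8; Serre1980Trees II §1.3].  The (W′-B6) shell average is `fbar m x = ∫_{K × U(Φ₁)_v} f(k⁻¹ · (E₂⁻¹ X, a) · k) dν(k)` with `X ∈ U_w` the
shell conjugate of `x = (E₂⁻¹ X₀, a)` and `K ≤ U(Φ₂)(L⁺_v)` the root stabiliser through `ρ_w ∘ E₂`.  If `k̃ ∈ U_w` FIXES THE ROOT (`ρ_w(k̃)·x₀ = x₀`, e.g. a lift of an integral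
matrix `D ∈ GL₂(𝒪_v)`, ★ `exists_rhoVertexActPlace_root_eq_and_descent_eq`) then `(E₂⁻¹ k̃, 1) ∈ K × U(Φ₁)_v`, `(E₂⁻¹(k̃⁻¹ X k̃), a) = (E₂⁻¹ k̃, 1)⁻¹ (E₂⁻¹ X, a) (E₂⁻¹ k̃, 1)`, and the
`K × U₁`-average is UNCHANGED (★ `setIntegral_conj_eq_of_conj_by_mem`), while the projective descent of `X` moves to the normal form `ζ · ι(D⁻¹ g D)` (★ `descent_conj_eq_smul_map_conj`).
So the value of `fbar` may be computed at ANY renormalised representative — the step that makes the window values `β₁`-free and continuous in the torus parameter (census §1).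

* `prod_symm_conj_eq` (the `H_v` identity), `mk_symm_one_mem_prod_of_root_eq` (membership), **`setIntegral_conj_prod_eq_of_root_stabilizer`**,
  **`exists_descent_conj_and_setIntegral_conj_prod_eq`** (renormalise by a lift of `D ∈ GL₂(𝒪_v)` with `σ z · z · ι(det D) = 1`: new descent `ζ • ι(D⁻¹ g D)`, same average).

## References
* [LabesseLanglands1979] J.-P. Labesse, R. P. Langlands, *L-indistinguishability for SL(2)*, Canad. J. Math. 31 (1979): §2 p. 8.
* [Serre1980Trees] J.-P. Serre, *Trees* (1980): Ch. II §1.3.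
-/

set_option autoImplicit false

noncomputable section

open MeasureTheory Topology Set Function NumberField IsDedekindDomain
open scoped MatrixGroups Matrix ValuativeRel

namespace Literature.NumberTheory.Rogawski1990

open Literature.NumberTheory.Automorphic Literature.NumberTheory.Automorphic.UnitaryGroup Literature.NumberTheory.GaloisRepresentations
  Literature.NumberTheory.Automorphic.HermitianLatticeTree

variable (L : Type) [Field L] [NumberField L] [IsCMField L] (v : HeightOneSpectrum (𝓞 ↥(maximalRealSubfield L)))
  (w : PlacesOver L v) (hw : IsCMField.complexConj L • w.1 = w.1)
  {α : w.1.adicCompletion L} (hα : galAdicCompletionMap (L := L) (IsCMField.complexConj L) hw α = -α) (hα0 : α ≠ 0)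
  {ϖF : v.adicCompletion ↥(maximalRealSubfield L)} (hϖF : Valued.v ϖF = WithZero.exp (-1 : ℤ))
  (E₂ : (cmDatum L 2 (Matrix.of fun i j : Fin 2 => if i.val + j.val + 1 = 2 then (1 : L) else 0)).Local v ≃ₜ* ↥(unitaryGroupOfForm (galAdicCompletionMap (L := L) (IsCMField.complexConj L) hw) (placeForm (Matrix.of fun i j : Fin 2 => if i.val + j.val + 1 = 2 then (1 : L) else 0) w.1)))
  (K : Subgroup ((cmDatum L 2 (Matrix.of fun i j : Fin 2 => if i.val + j.val + 1 = 2 then (1 : L) else 0)).Local v))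
  (x₀ : {M : Submodule 𝒪[v.adicCompletion ↥(maximalRealSubfield L)] (Fin 2 → v.adicCompletion ↥(maximalRealSubfield L)) // IsSpecialLattice (RingHom.id _) ϖF !![(0 : v.adicCompletion ↥(maximalRealSubfield L)), 1; -1, 0] M})
  (hK : ∀ g, g ∈ K ↔ rhoVertexActPlace L v w hw hα hα0 hϖF (E₂ g) x₀ = x₀)

/-- **The `H_v` identity**: `(E₂⁻¹(k̃⁻¹ X k̃), a) = (E₂⁻¹ k̃, 1)⁻¹ · (E₂⁻¹ X, a) · (E₂⁻¹ k̃, 1)`. [cite: LabesseLanglands1979, §2 p. 8] -/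
theorem prod_symm_conj_eq (kt X : ↥(unitaryGroupOfForm (galAdicCompletionMap (L := L) (IsCMField.complexConj L) hw) (placeForm (Matrix.of fun i j : Fin 2 => if i.val + j.val + 1 = 2 then (1 : L) else 0) w.1))) (a : (cmDatum L 1 (Matrix.of fun i j : Fin 1 => if i.val + j.val + 1 = 1 then (1 : L) else 0)).Local v) :
    ((E₂.symm (kt⁻¹ * X * kt), a) : ((cmDatum L 2 (Matrix.of fun i j : Fin 2 => if i.val + j.val + 1 = 2 then (1 : L) else 0)).Local v × (cmDatum L 1 (Matrix.of fun i j : Fin 1 => if i.val + j.val + 1 = 1 then (1 : L) else 0)).Local v)) = ((E₂.symm kt, (1 : (cmDatum L 1 (Matrix.of fun i j : Fin 1 => if i.val + j.val + 1 = 1 then (1 : L) else 0)).Local v)) : ((cmDatum L 2 (Matrix.of fun i j : Fin 2 => if i.val + j.val + 1 = 2 then (1 : L) else 0)).Local v × (cmDatum L 1 (Matrix.of fun i j : Fin 1 => if i.val + j.val + 1 = 1 then (1 : L) else 0)).Local v))⁻¹ * (E₂.symm X, a) * (E₂.symm kt, 1) := by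
  refine Prod.ext ?_ ?_
  · simp only [Prod.fst_mul, Prod.fst_inv, map_mul, map_inv]
  · simp only [Prod.snd_mul, Prod.snd_inv, inv_one, one_mul, mul_one]

include hK in
/-- A root-stabilising `k̃ ∈ U_w` gives `(E₂⁻¹ k̃, 1) ∈ K × U(Φ₁)_v`. [cite: Serre1980Trees, Ch. II §1.3] -/
theorem mk_symm_one_mem_prod_of_root_eq (kt : ↥(unitaryGroupOfForm (galAdicCompletionMap (L := L) (IsCMField.complexConj L) hw) (placeForm (Matrix.of fun i j : Fin 2 => if i.val + j.val + 1 = 2 then (1 : L) else 0) w.1))) (hkt : rhoVertexActPlace L v w hw hα hα0 hϖF kt x₀ = x₀) :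
    ((E₂.symm kt, (1 : (cmDatum L 1 (Matrix.of fun i j : Fin 1 => if i.val + j.val + 1 = 1 then (1 : L) else 0)).Local v)) : ((cmDatum L 2 (Matrix.of fun i j : Fin 2 => if i.val + j.val + 1 = 2 then (1 : L) else 0)).Local v × (cmDatum L 1 (Matrix.of fun i j : Fin 1 => if i.val + j.val + 1 = 1 then (1 : L) else 0)).Local v)) ∈ (K.prod (⊤ : Subgroup ((cmDatum L 1 (Matrix.of fun i j : Fin 1 => if i.val + j.val + 1 = 1 then (1 : L) else 0)).Local v)) : Subgroup ((cmDatum L 2 (Matrix.of fun i j : Fin 2 => if i.val + j.val + 1 = 2 then (1 : L) else 0)).Local v × (cmDatum L 1 (Matrix.of fun i j : Fin 1 => if i.val + j.val + 1 = 1 then (1 : L) else 0)).Local v)) := by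
  rw [Subgroup.mem_prod]
  refine ⟨(hK _).2 ?_, Subgroup.mem_top _⟩
  rw [ContinuousMulEquiv.apply_symm_apply]
  exact hkt

variable [MeasurableSpace ((cmDatum L 2 (Matrix.of fun i j : Fin 2 => if i.val + j.val + 1 = 2 then (1 : L) else 0)).Local v × (cmDatum L 1 (Matrix.of fun i j : Fin 1 => if i.val + j.val + 1 = 1 then (1 : L) else 0)).Local v)] [BorelSpace ((cmDatum L 2 (Matrix.of fun i j : Fin 2 => if i.val + j.val + 1 = 2 then (1 : L) else 0)).Local v × (cmDatum L 1 (Matrix.of fun i j : Fin 1 => if i.val + j.val + 1 = 1 then (1 : L) else 0)).Local v)] (ν : Measure ((cmDatum L 2 (Matrix.of fun i j : Fin 2 => if i.val + j.val + 1 = 2 then (1 : L) else 0)).Local v × (cmDatum L 1 (Matrix.of fun i j : Fin 1 => if i.val + j.val + 1 = 1 then (1 : L) else 0)).Local v)) [ν.IsMulLeftInvariant] {E : Type*} [NormedAddCommGroup E] [NormedSpace ℝ E]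

include hK in
/-- **THE SHELL AVERAGE IS UNCHANGED BY A ROOT-STABILISER RENORMALISATION**: for `k̃ ∈ U_w` with `ρ_w(k̃)·x₀ = x₀` and `K × U(Φ₁)_v` open,
`∫_{K×U₁} f(k⁻¹ (E₂⁻¹(k̃⁻¹ X k̃), a) k) dν = ∫_{K×U₁} f(k⁻¹ (E₂⁻¹ X, a) k) dν`. [cite: LabesseLanglands1979, §2 p. 8] -/
theorem setIntegral_conj_prod_eq_of_root_stabilizer (hKo : IsOpen (((K.prod (⊤ : Subgroup ((cmDatum L 1 (Matrix.of fun i j : Fin 1 => if i.val + j.val + 1 = 1 then (1 : L) else 0)).Local v))) : Subgroup ((cmDatum L 2 (Matrix.of fun i j : Fin 2 => if i.val + j.val + 1 = 2 then (1 : L) else 0)).Local v × (cmDatum L 1 (Matrix.of fun i j : Fin 1 => if i.val + j.val + 1 = 1 then (1 : L) else 0)).Local v)) : Set ((cmDatum L 2 (Matrix.of fun i j : Fin 2 => if i.val + j.val + 1 = 2 then (1 : L) else 0)).Local v × (cmDatum L 1 (Matrix.of fun i j : Fin 1 => if i.val + j.val + 1 = 1 then (1 : L) else 0)).Local v))) (f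 : ((cmDatum L 2 (Matrix.of fun i j : Fin 2 => if i.val + j.val + 1 = 2 then (1 : L) else 0)).Local v × (cmDatum L 1 (Matrix.of fun i j : Fin 1 => if i.val + j.val + 1 = 1 then (1 : L) else 0)).Local v) → E)
    (kt : ↥(unitaryGroupOfForm (galAdicCompletionMap (L := L) (IsCMField.complexConj L) hw) (placeForm (Matrix.of fun i j : Fin 2 => if i.val + j.val + 1 = 2 then (1 : L) else 0) w.1))) (hkt : rhoVertexActPlace L v w hw hα hα0 hϖF kt x₀ = x₀) (X : ↥(unitaryGroupOfForm (galAdicCompletionMap (L := L) (IsCMField.complexConj L) hw) (placeForm (Matrix.of fun i j : Fin 2 => if i.val + j.val + 1 = 2 then (1 : L) else 0) w.1))) (a : (cmDatum L 1 (Matrix.of fun i j : Fin 1 => if i.val + j.val + 1 = 1 then (1 : L) else 0)).Local v) :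
    ∫ k in (((K.prod (⊤ : Subgroup ((cmDatum L 1 (Matrix.of fun i j : Fin 1 => if i.val + j.val + 1 = 1 then (1 : L) else 0)).Local v))) : Subgroup ((cmDatum L 2 (Matrix.of fun i j : Fin 2 => if i.val + j.val + 1 = 2 then (1 : L) else 0)).Local v × (cmDatum L 1 (Matrix.of fun i j : Fin 1 => if i.val + j.val + 1 = 1 then (1 : L) else 0)).Local v)) : Set ((cmDatum L 2 (Matrix.of fun i j : Fin 2 => if i.val + j.val + 1 = 2 then (1 : L) else 0)).Local v × (cmDatum L 1 (Matrix.of fun i j : Fin 1 => if i.val + j.val + 1 = 1 then (1 : L) else 0)).Local v)), f (k⁻¹ * ((E₂.symm (kt⁻¹ * X * kt), a) : ((cmDatum L 2 (Matrix.of fun i j : Fin 2 => if i.val + j.val + 1 = 2 then (1 : L) else 0)).Local v × (cmDatum L 1 (Matrix.of fun i j : Fin 1 => if i.val + j.val + 1 = 1 then (1 : L) else 0)).Local v)) * k) ∂ν =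
      ∫ k in (((K.prod (⊤ : Subgroup ((cmDatum L 1 (Matrix.of fun i j : Fin 1 => if i.val + j.val + 1 = 1 then (1 : L) else 0)).Local v))) : Subgroup ((cmDatum L 2 (Matrix.of fun i j : Fin 2 => if i.val + j.val + 1 = 2 then (1 : L) else 0)).Local v × (cmDatum L 1 (Matrix.of fun i j : Fin 1 => if i.val + j.val + 1 = 1 then (1 : L) else 0)).Local v)) : Set ((cmDatum L 2 (Matrix.of fun i j : Fin 2 => if i.val + j.val + 1 = 2 then (1 : L) else 0)).Local v × (cmDatum L 1 (Matrix.of fun i j : Fin 1 => if i.val + j.val + 1 = 1 then (1 : L) else 0)).Local v)), f (k⁻¹ * ((E₂.symm X, a) : ((cmDatum L 2 (Matrix.of fun i j : Fin 2 => if i.val + j.val + 1 = 2 then (1 : L) else 0)).Local v × (cmDatum L 1 (Matrix.of fun i j : Fin 1 => if i.val + j.val + 1 = 1 then (1 : L) else 0)).Local v)) * k) ∂ν := by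
  rw [prod_symm_conj_eq L v w hw E₂ kt X a]
  exact setIntegral_conj_eq_of_conj_by_mem ν (K.prod (⊤ : Subgroup ((cmDatum L 1 (Matrix.of fun i j : Fin 1 => if i.val + j.val + 1 = 1 then (1 : L) else 0)).Local v))) hKo f
    (mk_symm_one_mem_prod_of_root_eq L v w hw hα hα0 hϖF E₂ K x₀ hK kt hkt) _

include hK in
/-- **RENORMALISING BY A LIFT OF AN INTEGRAL MATRIX**: if `X ∈ U_w` has descent `diag(1,α) X diag(1,α)⁻¹ = ζ · ι(g)` and `D ∈ GL₂(𝒪_v)` admits a scalar `z` with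
`σ_w(z) z ι(det D) = 1` (its determinant is a norm), then some `X′ ∈ U_w` has descent `ζ · ι(D⁻¹ g D)` and the SAME `K × U(Φ₁)_v`-average at every `a ∈ U(Φ₁)_v` — `X′ = k̃⁻¹ X k̃` for
the root-stabilising lift `k̃` of `D` (★ `exists_rhoVertexActPlace_root_eq_and_descent_eq`, ★ `descent_conj_eq_smul_map_conj`). [cite: LabesseLanglands1979, §2 p. 8]
[cite: Serre1980Trees, Ch. II §1.3] -/
theorem exists_descent_conj_and_setIntegral_conj_prod_eq [IsDiscreteValuationRing 𝒪[v.adicCompletion ↥(maximalRealSubfield L)]]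
    (hKo : IsOpen (((K.prod (⊤ : Subgroup ((cmDatum L 1 (Matrix.of fun i j : Fin 1 => if i.val + j.val + 1 = 1 then (1 : L) else 0)).Local v))) : Subgroup ((cmDatum L 2 (Matrix.of fun i j : Fin 2 => if i.val + j.val + 1 = 2 then (1 : L) else 0)).Local v × (cmDatum L 1 (Matrix.of fun i j : Fin 1 => if i.val + j.val + 1 = 1 then (1 : L) else 0)).Local v)) : Set ((cmDatum L 2 (Matrix.of fun i j : Fin 2 => if i.val + j.val + 1 = 2 then (1 : L) else 0)).Local v × (cmDatum L 1 (Matrix.of fun i j : Fin 1 => if i.val + j.val + 1 = 1 then (1 : L) else 0)).Local v))) (hx₀ : x₀.1 = latt (1 : Matrix (Fin 2) (Fin 2) (v.adicCompletion ↥(maximalRealSubfield L))))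
    {z : w.1.adicCompletion L} {D : GL (Fin 2) (v.adicCompletion ↥(maximalRealSubfield L))} (hD : D ∈ glInt 2 (v.adicCompletion ↥(maximalRealSubfield L)))
    (hzD : galAdicCompletionMap (L := L) (IsCMField.complexConj L) hw z * z * toPlace v w (D : Matrix (Fin 2) (Fin 2) _).det = 1)
    (X : ↥(unitaryGroupOfForm (galAdicCompletionMap (L := L) (IsCMField.complexConj L) hw) (placeForm (Matrix.of fun i j : Fin 2 => if i.val + j.val + 1 = 2 then (1 : L) else 0) w.1))) {ζ : w.1.adicCompletion L} {g : GL (Fin 2) (v.adicCompletion ↥(maximalRealSubfield L))}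
    (hX : Matrix.diagonal ![1, α] * ((X : GL (Fin 2) (w.1.adicCompletion L)) : Matrix (Fin 2) (Fin 2) (w.1.adicCompletion L)) * Matrix.diagonal ![1, α⁻¹] =
      ζ • (g : Matrix (Fin 2) (Fin 2) (v.adicCompletion ↥(maximalRealSubfield L))).map (toPlace v w)) :
    ∃ X' : ↥(unitaryGroupOfForm (galAdicCompletionMap (L := L) (IsCMField.complexConj L) hw) (placeForm (Matrix.of fun i j : Fin 2 => if i.val + j.val + 1 = 2 then (1 : L) else 0) w.1)),
      Matrix.diagonal ![1, α] * ((X' : GL (Fin 2) (w.1.adicCompletion L)) : Matrix (Fin 2) (Fin 2) (w.1.adicCompletion L)) * Matrix.diagonal ![1, α⁻¹] =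
        ζ • ((D⁻¹ * g * D : GL (Fin 2) (v.adicCompletion ↥(maximalRealSubfield L))) : Matrix (Fin 2) (Fin 2) (v.adicCompletion ↥(maximalRealSubfield L))).map (toPlace v w) ∧
      ∀ (f : ((cmDatum L 2 (Matrix.of fun i j : Fin 2 => if i.val + j.val + 1 = 2 then (1 : L) else 0)).Local v × (cmDatum L 1 (Matrix.of fun i j : Fin 1 => if i.val + j.val + 1 = 1 then (1 : L) else 0)).Local v) → E) (a : (cmDatum L 1 (Matrix.of fun i j : Fin 1 => if i.val + j.val + 1 = 1 then (1 : L) else 0)).Local v),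
        ∫ k in (((K.prod (⊤ : Subgroup ((cmDatum L 1 (Matrix.of fun i j : Fin 1 => if i.val + j.val + 1 = 1 then (1 : L) else 0)).Local v))) : Subgroup ((cmDatum L 2 (Matrix.of fun i j : Fin 2 => if i.val + j.val + 1 = 2 then (1 : L) else 0)).Local v × (cmDatum L 1 (Matrix.of fun i j : Fin 1 => if i.val + j.val + 1 = 1 then (1 : L) else 0)).Local v)) : Set ((cmDatum L 2 (Matrix.of fun i j : Fin 2 => if i.val + j.val + 1 = 2 then (1 : L) else 0)).Local v × (cmDatum L 1 (Matrix.of fun i j : Fin 1 => if i.val + j.val + 1 = 1 then (1 : L) else 0)).Local v)), f (k⁻¹ * ((E₂.symm X', a) : ((cmDatum L 2 (Matrix.of fun i j : Fin 2 => if i.val + j.val + 1 = 2 then (1 : L) else 0)).Local v × (cmDatum L 1 (Matrix.of fun i j : Fin 1 => if i.val + j.val + 1 = 1 then (1 : L) else 0)).Local v)) * k) ∂ν = ∫ k in (((K.prod (⊤ : Subgroup ((cmDatum L 1 (Matrix.of fun i j : Fin 1 => if i.val + j.val + 1 = 1 then (1 : L) else 0)).Local v))) : Subgroup ((cmDatum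 L 2 (Matrix.of fun i j : Fin 2 => if i.val + j.val + 1 = 2 then (1 : L) else 0)).Local v × (cmDatum L 1 (Matrix.of fun i j : Fin 1 => if i.val + j.val + 1 = 1 then (1 : L) else 0)).Local v)) : Set ((cmDatum L 2 (Matrix.of fun i j : Fin 2 => if i.val + j.val + 1 = 2 then (1 : L) else 0)).Local v × (cmDatum L 1 (Matrix.of fun i j : Fin 1 => if i.val + j.val + 1 = 1 then (1 : L) else 0)).Local v)), f (k⁻¹ * ((E₂.symm X, a) : ((cmDatum L 2 (Matrix.of fun i j : Fin 2 => if i.val + j.val + 1 = 2 then (1 : L) else 0)).Local v × (cmDatum L 1 (Matrix.of fun i j : Fin 1 => if i.val + j.val + 1 = 1 then (1 : L) else 0)).Local v)) * k) ∂ν := by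
  obtain ⟨kt, hroot, hdesc⟩ := exists_rhoVertexActPlace_root_eq_and_descent_eq L v w hw hα hα0 hϖF hD hzD x₀ hx₀
  have hz : z ≠ 0 := by
    rintro rfl
    rw [mul_zero, zero_mul] at hzD
    exact zero_ne_one hzD
  refine ⟨kt⁻¹ * X * kt, ?_, fun f a => setIntegral_conj_prod_eq_of_root_stabilizer L v w hw hα hα0 hϖF E₂ K x₀ hK ν hKo f kt hroot X a⟩
  have h := descent_conj_eq_smul_map_conj (toPlace v w) hα0 hz (X := (X : GL (Fin 2) (w.1.adicCompletion L))) (k := (kt : GL (Fin 2) (w.1.adicCompletion L))) hX hdesc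
  rw [Subgroup.coe_mul, Subgroup.coe_mul, Subgroup.coe_inv]
  exact h

end Literature.NumberTheory.Rogawski1990

end
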